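import Mathlib
import Summits.Ventures.DiscreteObjects.Mahler.CyclotomicIntegerLehmerAll
import Summits.Ventures.DiscreteObjects.Mahler.SmythIsolationEquality

/-!
# Lehmer's conjecture for the ring of integers of every cyclotomic field (venture `DiscreteObjects`, target L)

Cell `pub-namedobj`, seat `pub-namedobj-mahler-g28`. Framing: lottery ticket; floor = certified bounds/negative ranges.

`CyclotomicIntegerLehmerAll` proves [cite: BombieriGubler2001, Theorem 4.4.9] (`h(α) ≥ log(5/2)/10`) for the cyclotomic
integers presented as `α = g(ζ_m)`, `g ∈ ℤ[X]`.  Here the presentation is removed using Mathlib's theorem that the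
ring of integers of `ℚ(ζ_m)` is `ℤ[ζ_m]` (`IsCyclotomicExtension.Rat.isIntegralClosure_adjoin_singleton`, transported
to the subfield `ℚ(ζ) ⊂ ℂ`): **every algebraic integer `α` of `ℚ(ζ_m) ⊂ ℂ` which is neither `0` nor a root of
unity satisfies `(5/2)^{deg α} ≤ M(α)^{10}` and `M(α) > M(ℓ) = 1.17628…`** (`lehmer_of_isIntegral_mem_cyclotomicField`),
for every `m ≥ 1`.  Census reading: a sub-Lehmer integer polynomial has no root which is a nonzero non-torsion
algebraic integer of a cyclotomic field (`subLehmer_root_mem_cyclotomicField_torsion`,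
`subLehmer_root_cyclotomicInteger_torsion_all` — every conductor, superseding the bound `m < 3·5·…·31` of
`CyclotomicIntegerSmallConductor`).  REPLICATION / bookkeeping; no new mathematics claimed.
-/

namespace Summit.Ventures.DiscreteObjects.Mahler

open Polynomial Finset

/-- **Every algebraic integer of `ℚ(ζ_m) ⊂ ℂ` is a cyclotomic integer `g(ζ_m)`, `g ∈ ℤ[X]`** (the ring of integers of
the cyclotomic field is `ℤ[ζ_m]`; Mathlib's `IsCyclotomicExtension.Rat.isIntegralClosure_adjoin_singleton`, transported
to the subfield `ℚ(ζ) ⊂ ℂ`). -/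
theorem exists_aeval_eq_of_isIntegral_of_mem_adjoin {m : ℕ} (hm : 0 < m) {ζ : ℂ} (hζ : IsPrimitiveRoot ζ m) {α : ℂ}
    (hα : α ∈ IntermediateField.adjoin ℚ {ζ}) (hint : IsIntegral ℤ α) : ∃ g : ℤ[X], α = aeval ζ g := by
  haveI : NeZero m := ⟨hm.ne'⟩
  set K : IntermediateField ℚ ℂ := IntermediateField.adjoin ℚ {ζ} with hK
  have hζalg : IsAlgebraic ℚ ζ := ((hζ.isIntegral hm).tower_top (A := ℚ)).isAlgebraic
  haveI : IsCyclotomicExtension {m} ℚ K := by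
    change IsCyclotomicExtension {m} ℚ (IntermediateField.adjoin ℚ {ζ}).toSubalgebra
    rw [IntermediateField.adjoin_simple_toSubalgebra_of_isAlgebraic hζalg]
    exact hζ.adjoin_isCyclotomicExtension ℚ
  set ζ' : K := ⟨ζ, IntermediateField.mem_adjoin_simple_self ℚ ζ⟩ with hζ'
  have hζ'prim : IsPrimitiveRoot ζ' m := IsPrimitiveRoot.coe_submonoidClass_iff.1 (by exact hζ)
  have hIC := IsCyclotomicExtension.Rat.isIntegralClosure_adjoin_singleton hζ'prim
  set α' : K := ⟨α, hα⟩ with hα'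
  -- `α'` is integral over `ℤ`
  set ι : K →ₐ[ℤ] ℂ := IsScalarTower.toAlgHom ℤ K ℂ with hι
  have hιinj : Function.Injective ι := (algebraMap K ℂ).injective
  have hια : ι α' = α := rfl
  have hint' : IsIntegral ℤ α' := (isIntegral_algHom_iff ι hιinj).1 (by rw [hια]; exact hint)
  obtain ⟨y, hy⟩ := (hIC.isIntegral_iff).1 hint'
  have hymem : (y : K) ∈ Algebra.adjoin ℤ {ζ'} := y.2
  rw [Algebra.adjoin_singleton_eq_range_aeval] at hymem
  obtain ⟨g, hg⟩ := hymem
  refine ⟨g, ?_⟩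
  have h1 : (aeval ζ' g : K) = α' := by
    rw [← hy]
    change aeval ζ' g = (y : K)
    exact hg
  have h2 : ι (aeval ζ' g) = aeval (ι ζ') g := (aeval_algHom_apply ι ζ' g).symm
  have hιζ : ι ζ' = ζ := rfl
  rw [h1, hια, hιζ] at h2
  exact h2

/-- **Lehmer's conjecture for the ring of integers of every cyclotomic field.**  For `m ≥ 1`, a primitive `m`-th root
of unity `ζ ∈ ℂ`, and an algebraic integer `α ∈ ℚ(ζ)` which is neither `0` nor a root of unity:
`(5/2)^{deg α} ≤ M(α)^{10}` and `M(α) > M(ℓ)`. -/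
theorem lehmer_of_isIntegral_mem_cyclotomicField {m : ℕ} (hm : 0 < m) {ζ : ℂ} (hζ : IsPrimitiveRoot ζ m) {α : ℂ}
    (hα : α ∈ IntermediateField.adjoin ℚ {ζ}) (hint : IsIntegral ℤ α) (h0 : α ≠ 0)
    (hnu : ∀ k : ℕ, 0 < k → α ^ k ≠ 1) :
    ((5 : ℝ) / 2) ^ (minpoly ℤ α).natDegree ≤ intMahlerMeasure (minpoly ℤ α) ^ 10 ∧
      intMahlerMeasure lehmerPoly < intMahlerMeasure (minpoly ℤ α) := by
  obtain ⟨g, rfl⟩ := exists_aeval_eq_of_isIntegral_of_mem_adjoin hm hζ hα hint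
  exact ⟨cyclotomicInteger_lehmer_bound_all hm g hζ h0 hnu, lehmer_of_cyclotomicInteger_all hm g hζ h0 hnu⟩

/-- **Census reading, every conductor** (cell vocabulary `SubLehmer P : 1 < M(P) < M(ℓ)`): a complex root of a
sub-Lehmer integer polynomial which is an algebraic integer of some cyclotomic field `ℚ(ζ_m)` is `0` or a root of
unity — sub-Lehmer polynomials have no non-torsion root in any `𝓞_{ℚ(ζ_m)} = ℤ[ζ_m]`. -/
theorem subLehmer_root_mem_cyclotomicField_torsion {P : ℤ[X]} (hP : SubLehmer P) {m : ℕ} (hm : 0 < m) {ζ : ℂ}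
    (hζ : IsPrimitiveRoot ζ m) {α : ℂ} (hα : α ∈ IntermediateField.adjoin ℚ {ζ}) (hint : IsIntegral ℤ α)
    (hroot : aeval α P = 0) : α = 0 ∨ ∃ k : ℕ, 0 < k ∧ α ^ k = 1 := by
  by_contra hcon
  have h0 : α ≠ 0 := fun h => hcon (Or.inl h)
  have hnu : ∀ k : ℕ, 0 < k → α ^ k ≠ 1 := fun k hk h => hcon (Or.inr ⟨k, hk, h⟩)
  have hdvd : minpoly ℤ α ∣ P := minpoly.isIntegrallyClosed_dvd hint hroot
  have hP0 : P ≠ 0 := by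
    intro h
    have h1 := hP.1
    rw [h] at h1
    unfold intMahlerMeasure at h1
    rw [Polynomial.map_zero, mahlerMeasure_zero] at h1
    linarith
  have h1 := intMahlerMeasure_le_of_dvd hP0 hdvd
  have h2 := (lehmer_of_isIntegral_mem_cyclotomicField hm hζ hα hint h0 hnu).2
  have h3 := hP.2
  linarith

/-- In particular (the case `α = g(ζ)`, `g ∈ ℤ[X]`, every conductor `m`): the roots of a sub-Lehmer polynomial in
`ℤ[ζ_m]` are `0` or roots of unity. -/
theorem subLehmer_root_cyclotomicInteger_torsion_all {P : ℤ[X]} (hP : SubLehmer P) {m : ℕ} (hm : 0 < m) {ζ : ℂ}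
    (hζ : IsPrimitiveRoot ζ m) (g : ℤ[X]) (hroot : aeval (aeval ζ g) P = 0) :
    aeval ζ g = 0 ∨ ∃ k : ℕ, 0 < k ∧ aeval ζ g ^ k = 1 := by
  refine subLehmer_root_mem_cyclotomicField_torsion hP hm hζ ?_ (isIntegral_aeval_of_isPrimitiveRoot hm g hζ) hroot
  rw [Polynomial.aeval_eq_sum_range]
  refine sum_mem fun i _ => ?_
  rw [Algebra.smul_def, algebraMap_int_eq, eq_intCast]
  refine mul_mem ?_ (pow_mem (IntermediateField.mem_adjoin_simple_self ℚ ζ) i)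
  exact_mod_cast intCast_mem (IntermediateField.adjoin ℚ {ζ}) (g.coeff i)

end Summit.Ventures.DiscreteObjects.Mahler
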